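import Summits.NavierStokesRegularity.NavierStokesRegularity.Theorems.PalasekTowerBreakdownSterileTowerFinite
import Summits.NavierStokesRegularity.FluidComputer.AxisymNoSwirlForcedGlobal

/-!
# NavierStokesRegularity — route `PalasekTowerBreakdown`: the FORCED AXISYMMETRIC SWIRL-FREE class is
# sterile too — finite registered towers, no realisation, and under the child / the parent an EMPTY
# register at the generic levels (any axisymmetric swirl-free Clay force, not only `S.f ≡ 0`)

Supports `stmt-NavierStokesRegularity-19250` (`PalasekTowerBreakdown.HeredityFromTwo := HeredityFrom 2`)
as a helper; FORCED twin of ns-palasek-19250-p1's `…HeredityFromTwoSterile` (p446857) and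
`…SterileTowerFinite` (p447478), which needed `S.f ≡ 0` on `[0, ∞)` because the only no-swirl
regularity theorem in the tree was the UNFORCED Ladyzhenskaya / Ukhovskii–Yudovich
(`axisymmetric_no_swirl_global_regularity_holds`). Cell `ns-blowup`, seat `ns-blowup-lean` (g9).
LABEL: E–C typing + kernel bookkeeping (theorems only; no definition; NO named fact — the input is the
FORCED regularity theorem `FluidComputer.exists_claySolution_of_axisym_noSwirl`, lean g9 p453245, after
Ladyzhenskaya 1968 WITH force / Lemarié-Rieusset 2016 Thm. 10.4). WHAT THIS IS NOT: not Navier–Stokes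
evidence and NOT a refutation of any item — no stage is constructed; the one remaining hypothesis of
each template is an OPEN construction (a registered stage of a forced axisymmetric swirl-free design).

Design class: a schedule `S` (any rates `R`) whose datum `S.u₀` is axisymmetric without swirl and whose
force slices `S.f t` are axisymmetric without swirl for every `t ≥ 0` (the register's preparation /
window forces may be anything inside that class; `S.f ≡ 0` is the special case of p446857/p447478).

* `palasekTowerBreakdown_exists_global_solution_of_noSwirl_forced_rates` — such a design carrying any
  stage has a classical finite-energy solution of ITS OWN FORCED Cauchy problem on every closed slab;
* `palasekTowerBreakdown_noSwirl_forced_tower_finite` — its registered tower is FINITE for any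
  `ν > 0`, rates, margins (`∃ K, ∀ k ≥ K, IsEmpty (Stage ν R S m k)`); `…_not_all_levels`;
  `…_exists_top_level_of_noSwirl_forced_stage`;
* `palasekTowerBreakdown_not_heredityFromTwo_of_noSwirl_forced_stage` — a pinned rigid quiet wide such
  design with a registered stage at a level `k₀ ≥ 2` refutes the CHILD (no cap, no fact);
  `…_heredityFromTwo_isEmpty_noSwirl_forced_stage`; the PARENT from `k₀ ≥ 1`
  (`…_not_episodeInduction_of_noSwirl_forced_stage`, `…_episodeInduction_isEmpty_noSwirl_forced_stage`);
* `palasekTowerBreakdown_not_heredityAt_top_of_noSwirl_forced_stage`,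
  `palasekTowerBreakdown_not_atOne_or_not_fromTwo_of_noSwirl_forced_stage_one` — the top-level form.

References: O. A. Ladyzhenskaya, Zap. Naučn. Sem. LOMI 7 (1968); M. R. Ukhovskii, V. I. Yudovich
(1968) — through P. G. Lemarié-Rieusset (2016), Thm. 10.4 [cite: LemarieRieusset2016, Thm 10.4 (p. 285)];
T. Tao, Anal. PDE 6 (2013), Cor. 11.4 [cite: Tao2011, Cor. 11.4]; S. Palasek, arXiv:2605.13827 §4
[cite: Palasek2026ElementaryModel, §4].
-/

-- `Summit.<Summit>.<Problem>` is the tree's mandated summit-side namespace (CONVENTIONS §2); for this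
-- single-conjunct summit the two coincide, so the duplicate is deliberate.
set_option linter.dupNamespace false

noncomputable section

namespace Summit.NavierStokesRegularity.NavierStokesRegularity.Theorems

open Set MeasureTheory Filter Topology Function
open scoped ENNReal ContDiff
open Summit.NavierStokesRegularity.NavierStokesRegularity.Theses
open Summit.NavierStokesRegularity.FluidComputer
open Summit.NavierStokesRegularity.FluidComputer.PalasekTowerClayBridge
open Literature.Analysis.FluidPDE

section AnyRates

variable {ν : ℝ} {R : TowerRates} {S : Schedule R} {m : Margins R}

/-- **A FORCED axisymmetric swirl-free design that carries any stage has a GLOBAL classical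
finite-energy solution of its own forced Cauchy problem on every closed slab** (any viscosity `ν > 0`,
rates, margins): the forced Ladyzhenskaya / Ukhovskii–Yudovich theorem
(`exists_claySolution_of_axisym_noSwirl`) fed with the Clay datum `S.u₀` (smooth and divergence free as
the slice `t = 0` of the stage) and the Clay force `S.f` (axisymmetric swirl-free slices, `t ≥ 0`).
[cite: LemarieRieusset2016, Thm 10.4 (p. 285)] -/
theorem palasekTowerBreakdown_exists_global_solution_of_noSwirl_forced_rates (hν : 0 < ν) {k : ℕ}
    (s : Stage ν R S m k) (hfA : ∀ t : ℝ, 0 ≤ t → IsAxisymmetric (S.f t))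
    (hfS : ∀ t : ℝ, 0 ≤ t → HasNoSwirl (S.f t)) (h0A : IsAxisymmetric S.u₀) (h0S : HasNoSwirl S.u₀)
    {T' : ℝ} (hT' : 0 < T') :
    ∃ (U : ℝ → EuclideanSpace ℝ (Fin 3) → EuclideanSpace ℝ (Fin 3))
      (P : ℝ → EuclideanSpace ℝ (Fin 3) → ℝ),
      IsClassicalNSSolutionOn (Icc 0 T') ν S.f U P ∧ U 0 = S.u₀ ∧
      (∃ C : ℝ≥0∞, C < ⊤ ∧ ∀ t ∈ Icc 0 T', ∫⁻ x, ‖U t x‖ₑ ^ 2 ≤ C) := by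
  have hsmooth : ContDiff ℝ ∞ S.u₀ := s.contDiff_datum
  have hdiv : VectorCalculus.IsDivFree S.u₀ := by
    rw [← s.initial]
    exact s.classical.divFree 0 ⟨le_rfl, (S.τ_pos k).le⟩
  obtain ⟨U, P, hU, hP, hns, ⟨C, hC, hCb⟩⟩ :=
    exists_claySolution_of_axisym_noSwirl hν hsmooth (fun x => hdiv x) S.datum_decay S.force_smooth
      S.force_decay h0A h0S hfA hfS
  obtain ⟨hcl, hU0⟩ := isNavierStokesSolution_and_smooth_iff.1 ⟨hns, hU, hP⟩
  exact ⟨U, P, hcl.mono Icc_subset_Ici_self (uniqueDiffOn_Icc hT'), hU0,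
    ⟨C, hC, fun t ht => hCb t ht.1⟩⟩

/-- **THE REGISTERED TOWER OF A FORCED AXISYMMETRIC SWIRL-FREE DESIGN IS FINITE** (any viscosity
`ν > 0`, rates `R`, margins `m`; no crux, no named fact): if `S.u₀` and every `S.f t`, `t ≥ 0`, are
axisymmetric without swirl then `∃ K, ∀ k ≥ K, IsEmpty (Stage ν R S m k)`. Proof as in the unforced
p447478: the design's global classical solution `U` is bounded by some `M` on the compact box
`[0, S.T] × B̄(0, S.radius)`; every registered stage equals `U` on its slab (forced uniqueness) and reads
a speed `≥ c₁ Y_k` in the box at `τ_k < S.T`; `c₁ Y_k → ∞`.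
[cite: LemarieRieusset2016, Thm 10.4 (p. 285); Tao2011, Cor. 11.4] -/
theorem palasekTowerBreakdown_noSwirl_forced_tower_finite (hν : 0 < ν)
    (hfA : ∀ t : ℝ, 0 ≤ t → IsAxisymmetric (S.f t)) (hfS : ∀ t : ℝ, 0 ≤ t → HasNoSwirl (S.f t))
    (h0A : IsAxisymmetric S.u₀) (h0S : HasNoSwirl S.u₀) :
    ∃ K : ℕ, ∀ k : ℕ, K ≤ k → IsEmpty (Stage ν R S m k) := by
  by_cases hex : ∃ k, Nonempty (Stage ν R S m k)
  · obtain ⟨k₁, ⟨s₁⟩⟩ := hex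
    obtain ⟨U, P, hU, hU0, hUE⟩ :=
      palasekTowerBreakdown_exists_global_solution_of_noSwirl_forced_rates hν s₁ hfA hfS h0A h0S
        S.T_pos
    obtain ⟨M, hM⟩ := palasekTowerBreakdown_solution_bounded_on_ball_visc (r := S.radius) hU
    have hev : ∀ᶠ k in atTop, M < S.c₁ * R.Y k :=
      ((R.tendsto_Y_atTop.const_mul_atTop S.c₁_pos).eventually_gt_atTop M)
    obtain ⟨K, hK⟩ := eventually_atTop.1 hev
    refine ⟨K, fun k hk => ⟨fun s => ?_⟩⟩
    obtain ⟨x, hx, hfl⟩ := s.floor k le_rfl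
    have hτ : S.τ k ≤ S.T := (S.τ_lt_T k).le
    have heq : s.u (S.τ k) = U (S.τ k) :=
      palasekTowerBreakdown_stage_velocity_eq_solution_rates hν s hτ hU hU0 hUE (S.τ k)
        ⟨(S.τ_pos k).le, le_rfl⟩
    have hb := hM (S.τ k) ⟨(S.τ_pos k).le, hτ⟩ x hx
    rw [← heq] at hb
    linarith [hK k hk]
  · push Not at hex
    exact ⟨0, fun k _ => hex k⟩

/-- **No forced axisymmetric swirl-free design carries a registered stage at every level** — the
one-design door `navierStokesBreakdownR3_of_nonempty_stages` is shut on this class.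
[cite: LemarieRieusset2016, Thm 10.4 (p. 285)] -/
theorem palasekTowerBreakdown_noSwirl_forced_not_all_levels (hν : 0 < ν)
    (hfA : ∀ t : ℝ, 0 ≤ t → IsAxisymmetric (S.f t)) (hfS : ∀ t : ℝ, 0 ≤ t → HasNoSwirl (S.f t))
    (h0A : IsAxisymmetric S.u₀) (h0S : HasNoSwirl S.u₀) :
    ¬ ∀ k : ℕ, Nonempty (Stage ν R S m k) := by
  obtain ⟨K, hK⟩ := palasekTowerBreakdown_noSwirl_forced_tower_finite (m := m) hν hfA hfS h0A h0S
  exact fun h => (hK K le_rfl).false (h K).some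

/-- **A forced axisymmetric swirl-free design that carries SOME registered stage has a TOP level**: a
stage at `k*` and none at `k* + 1`. [folklore] -/
theorem palasekTowerBreakdown_exists_top_level_of_noSwirl_forced_stage (hν : 0 < ν)
    (hfA : ∀ t : ℝ, 0 ≤ t → IsAxisymmetric (S.f t)) (hfS : ∀ t : ℝ, 0 ≤ t → HasNoSwirl (S.f t))
    (h0A : IsAxisymmetric S.u₀) (h0S : HasNoSwirl S.u₀) {k₀ : ℕ} (s : Stage ν R S m k₀) :
    ∃ kstar : ℕ, k₀ ≤ kstar ∧ Nonempty (Stage ν R S m kstar) ∧ IsEmpty (Stage ν R S m (kstar + 1)) := by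
  obtain ⟨K, hK⟩ := palasekTowerBreakdown_noSwirl_forced_tower_finite (m := m) hν hfA hfS h0A h0S
  by_contra hcon
  push Not at hcon
  have hall : ∀ n : ℕ, Nonempty (Stage ν R S m (k₀ + n)) := by
    intro n
    induction n with
    | zero => exact ⟨s⟩
    | succ n ih => exact hcon (k₀ + n) (Nat.le_add_right k₀ n) ih
  have hKle : K ≤ k₀ + K := Nat.le_add_left K k₀
  exact (hK (k₀ + K) hKle).false (hall K).some

end AnyRates

/-! ## The route's register: child, parent, top level -/

section Register

variable {S : Schedule TowerRates.wide}

/-- **THE REFUTATION TEMPLATE FOR THE CHILD IN THE FORCED STERILE CLASS**: a pinned (`Λ = 8`,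
`θ = 6/5`) rigid quiet schedule on the wide-base rates whose datum AND force slices (`t ≥ 0`) are
axisymmetric without swirl, carrying a registered (globally anchored, route margins, unit viscosity)
stage at some level `k₀ ≥ 2`, REFUTES `HeredityFromTwo` — the design's global classical solution
(forced Ladyzhenskaya / Ukhovskii–Yudovich) contradicts the scheduled blow-up the child would force on
it (`palasekTowerBreakdown_heredityFromTwo_no_global_solution`, p446478). The stage is NOT constructed
here (open). [cite: LemarieRieusset2016, Thm 10.4 (p. 285); Palasek2026ElementaryModel, §4] -/
theorem palasekTowerBreakdown_not_heredityFromTwo_of_noSwirl_forced_stage (hP : S.Pins 8 (6 / 5))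
    (hR : S.Rigid) (hQ : S.Quiet) (hfA : ∀ t : ℝ, 0 ≤ t → IsAxisymmetric (S.f t))
    (hfS : ∀ t : ℝ, 0 ≤ t → HasNoSwirl (S.f t)) (h0A : IsAxisymmetric S.u₀) (h0S : HasNoSwirl S.u₀)
    {k₀ : ℕ} (hk₀ : 2 ≤ k₀) (s : Stage 1 TowerRates.wide S (Margins.routeG TowerRates.wide) k₀) :
    ¬ PalasekTowerBreakdown.HeredityFromTwo := by
  intro h
  obtain ⟨U, P, hU, hU0, hUE⟩ :=
    palasekTowerBreakdown_exists_global_solution_of_noSwirl_forced_rates one_pos s hfA hfS h0A h0S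
      S.T_pos
  exact palasekTowerBreakdown_heredityFromTwo_no_global_solution h hP hR hQ hk₀ s le_rfl hU hU0 hUE

/-- **Under the child, the FORCED axisymmetric swirl-free register is EMPTY at every generic level**
`k ≥ 2`. [cite: LemarieRieusset2016, Thm 10.4 (p. 285); Palasek2026ElementaryModel, §4] -/
theorem palasekTowerBreakdown_heredityFromTwo_isEmpty_noSwirl_forced_stage
    (h : PalasekTowerBreakdown.HeredityFromTwo) (hP : S.Pins 8 (6 / 5)) (hR : S.Rigid) (hQ : S.Quiet)
    (hfA : ∀ t : ℝ, 0 ≤ t → IsAxisymmetric (S.f t)) (hfS : ∀ t : ℝ, 0 ≤ t → HasNoSwirl (S.f t))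
    (h0A : IsAxisymmetric S.u₀) (h0S : HasNoSwirl S.u₀) {k : ℕ} (hk : 2 ≤ k) :
    IsEmpty (Stage 1 TowerRates.wide S (Margins.routeG TowerRates.wide) k) :=
  ⟨fun s => palasekTowerBreakdown_not_heredityFromTwo_of_noSwirl_forced_stage hP hR hQ hfA hfS h0A
    h0S hk s h⟩

/-- `∃`-form of the template: «some forced axisymmetric swirl-free pinned rigid quiet wide design
carries a registered stage at a level `≥ 2`» refutes the child. [cite: Palasek2026ElementaryModel, §4] -/
theorem palasekTowerBreakdown_not_heredityFromTwo_of_exists_noSwirl_forced_rung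
    (hW : ∃ (S : Schedule TowerRates.wide) (k : ℕ), S.Pins 8 (6 / 5) ∧ S.Rigid ∧ S.Quiet ∧
      (∀ t : ℝ, 0 ≤ t → IsAxisymmetric (S.f t)) ∧ (∀ t : ℝ, 0 ≤ t → HasNoSwirl (S.f t)) ∧
      IsAxisymmetric S.u₀ ∧ HasNoSwirl S.u₀ ∧ 2 ≤ k ∧
      Nonempty (Stage 1 TowerRates.wide S (Margins.routeG TowerRates.wide) k)) :
    ¬ PalasekTowerBreakdown.HeredityFromTwo := by
  obtain ⟨S, k, hP, hR, hQ, hfA, hfS, h0A, h0S, hk, ⟨s⟩⟩ := hW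
  exact palasekTowerBreakdown_not_heredityFromTwo_of_noSwirl_forced_stage hP hR hQ hfA hfS h0A h0S hk s

/-- **The refutation template for the PARENT in the forced sterile class**: a forced axisymmetric
swirl-free pinned rigid quiet wide design carrying a registered stage at some level `k₀ ≥ 1` refutes
`EpisodeInduction` (via the level-`≥ 1` ladder of p446857).
[cite: LemarieRieusset2016, Thm 10.4 (p. 285); Palasek2026ElementaryModel, §4] -/
theorem palasekTowerBreakdown_not_episodeInduction_of_noSwirl_forced_stage (hP : S.Pins 8 (6 / 5))
    (hR : S.Rigid) (hQ : S.Quiet) (hfA : ∀ t : ℝ, 0 ≤ t → IsAxisymmetric (S.f t))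
    (hfS : ∀ t : ℝ, 0 ≤ t → HasNoSwirl (S.f t)) (h0A : IsAxisymmetric S.u₀) (h0S : HasNoSwirl S.u₀)
    {k₀ : ℕ} (hk₀ : 1 ≤ k₀) (s : Stage 1 TowerRates.wide S (Margins.routeG TowerRates.wide) k₀) :
    ¬ PalasekTowerBreakdown.EpisodeInduction := by
  intro h
  obtain ⟨U, P, hU, hU0, hUE⟩ :=
    palasekTowerBreakdown_exists_global_solution_of_noSwirl_forced_rates one_pos s hfA hfS h0A h0S
      S.T_pos
  exact palasekTowerBreakdown_episodeInduction_no_global_solution h hP hR hQ hk₀ s le_rfl hU hU0 hUE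

/-- Under the parent, the FORCED axisymmetric swirl-free register is EMPTY at EVERY level `k ≥ 1`.
[cite: LemarieRieusset2016, Thm 10.4 (p. 285); Palasek2026ElementaryModel, §4] -/
theorem palasekTowerBreakdown_episodeInduction_isEmpty_noSwirl_forced_stage
    (h : PalasekTowerBreakdown.EpisodeInduction) (hP : S.Pins 8 (6 / 5)) (hR : S.Rigid) (hQ : S.Quiet)
    (hfA : ∀ t : ℝ, 0 ≤ t → IsAxisymmetric (S.f t)) (hfS : ∀ t : ℝ, 0 ≤ t → HasNoSwirl (S.f t))
    (h0A : IsAxisymmetric S.u₀) (h0S : HasNoSwirl S.u₀) {k : ℕ} (hk : 1 ≤ k) :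
    IsEmpty (Stage 1 TowerRates.wide S (Margins.routeG TowerRates.wide) k) :=
  ⟨fun s => palasekTowerBreakdown_not_episodeInduction_of_noSwirl_forced_stage hP hR hQ hfA hfS h0A
    h0S hk s h⟩

/-- **A forced sterile design of the route's register that carries a registered stage refutes heredity
at its TOP level**: there is `k* ≥ k₀` with `¬ HeredityAt k*`.
[cite: LemarieRieusset2016, Thm 10.4 (p. 285); Palasek2026ElementaryModel, §4] -/
theorem palasekTowerBreakdown_not_heredityAt_top_of_noSwirl_forced_stage (hP : S.Pins 8 (6 / 5))
    (hR : S.Rigid) (hQ : S.Quiet) (hfA : ∀ t : ℝ, 0 ≤ t → IsAxisymmetric (S.f t))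
    (hfS : ∀ t : ℝ, 0 ≤ t → HasNoSwirl (S.f t)) (h0A : IsAxisymmetric S.u₀) (h0S : HasNoSwirl S.u₀)
    {k₀ : ℕ} (s : Stage 1 TowerRates.wide S (Margins.routeG TowerRates.wide) k₀) :
    ∃ kstar : ℕ, k₀ ≤ kstar ∧ ¬ HeredityAt kstar := by
  obtain ⟨kstar, hk, ⟨s'⟩, hE⟩ :=
    palasekTowerBreakdown_exists_top_level_of_noSwirl_forced_stage one_pos hfA hfS h0A h0S s
  refine ⟨kstar, hk, fun hH => ?_⟩
  obtain ⟨s'', -⟩ := hH S hP hR hQ s'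
  exact hE.false s''

/-- **A forced sterile `RungG 1` exhibit refutes the parent and ONE of the two children.**
[cite: LemarieRieusset2016, Thm 10.4 (p. 285); Palasek2026ElementaryModel, §4] -/
theorem palasekTowerBreakdown_not_atOne_or_not_fromTwo_of_noSwirl_forced_stage_one
    (hP : S.Pins 8 (6 / 5)) (hR : S.Rigid) (hQ : S.Quiet)
    (hfA : ∀ t : ℝ, 0 ≤ t → IsAxisymmetric (S.f t)) (hfS : ∀ t : ℝ, 0 ≤ t → HasNoSwirl (S.f t))
    (h0A : IsAxisymmetric S.u₀) (h0S : HasNoSwirl S.u₀)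
    (s : Stage 1 TowerRates.wide S (Margins.routeG TowerRates.wide) 1) :
    ¬ PalasekTowerBreakdown.HeredityAtOne ∨ ¬ PalasekTowerBreakdown.HeredityFromTwo := by
  obtain ⟨kstar, hk, hH⟩ :=
    palasekTowerBreakdown_not_heredityAt_top_of_noSwirl_forced_stage hP hR hQ hfA hfS h0A h0S s
  rcases hk.eq_or_lt with h1 | h2
  · exact Or.inl fun h => hH (h1 ▸ heredityAtOne_iff.1 h)
  · exact Or.inr fun h => hH (HeredityFrom.heredityAt h h2)

end Register

end Summit.NavierStokesRegularity.NavierStokesRegularity.Theorems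

end
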